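import Summits.BirchSwinnertonDyer.Rank1Residual.Additive.GordIsogenyInvariance
import Summits.BirchSwinnertonDyer.Rank1Residual.Additive.GordKodairaType
import HarnessLib

/-!
# X3♯/X4♯ (G-ord): the census cell (G-ord) and the sub-classes X3♯(G-ord), X4♯(G-ord) are
# `ℚ`-ISOGENY-CLASS properties (every odd `p`); the Kodaira type moves at most `v ↦ 12 − v`

HONEST FRAMING (cell `b2b-bsdres`, run/shared/lean/b2b/bsd-rank1-residual/, verbatim in every
file): the goal of the cell is to DELETE the COMBINATION-SHAPED residual classes of the
Birch–Swinnerton-Dyer formula for ALL analytic-rank `≤ 1` elliptic curves over `ℚ` — "full BSD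
formula for every rank `≤ 1` curve in class `C`" assembled STRICTLY from published theorems — so
that the rank-`≤ 1` remainder becomes exactly the CONSTRUCTION-SHAPED classes, which are TYPED
(missing-input `Prop`s), NOT attempted. This is not "finishing BSD". Sub-cell `additive-p2`
(CLASS-OWNERS row "X3/X4 additive — pot. good ordinary / X3♯(G-ord)"), generation 15: research
route; no claim beyond the stated classes; theorems only, no definition, no new named fact;
X3♯(G-ord)/X4♯(G-ord) stay CONSTRUCTION-SHAPED; nothing is booked by this file.

WHAT THIS FILE DOES. Class-level form of `GordIsogenyInvariance.lean` (type (G), the defect and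
(G)-ordinarity transfer along `ℚ`-isogenies): for `W ∼ W'` over `ℚ` (globally minimal models),
* `subGord_iff_of_isIsogenous` — the census cell (G-ord) = `SubGord` (`SharpenedStatements.lean`) is
  a class property on the additive locus at every odd `p` (gen 9's uniform dictionary
  `subGord_iff_typeG_of_addv` on both sides + `typeG_iff_of_isIsogenous`);
* `ClassX4Gord.of_isIsogenous`, `classX4Gord_iff_of_isIsogenous` — **X4♯(G-ord) membership is constant
  on `ℚ`-isogeny classes** (no hypothesis on `p` beyond `ClassX4`'s own `p ≠ 2`): additivity by
  `Addv.of_isIsogenous_of_typeG`, irreducibility of `E'[p]` by the tree's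
  `not_hasIrreducibleModPGaloisRep_of_isIsogenous`, (G)-ordinarity by `TypeGOrd.of_isIsogenous`;
* `ClassX3Gord.of_isIsogenous`, `classX3Gord_iff_of_isIsogenous` — the same for X3♯(G-ord) (odd `p`;
  reducibility is a class property by the same lemma).
* `padicValInt_minimalDiscriminantInt_mem_of_addv_of_padicValRat_j_nonneg` — at a potentially good
  additive `p ≥ 5`, `ord_p Δ_min ∈ {2, 3, 4, 6, 8, 9, 10}` (gen 14's seven-type lemma with `Iₙ*`,
  `n ≥ 1`, removed by `ord_p j ≥ 0`: the tree's `one_lt_valuation_j_of_kodairaSymbolAt_eq_Istar_succ`);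
  hence **`padicValInt_minimalDiscriminantInt_eq_or_add_eq_twelve_of_isIsogenous_of_typeG`: for a
  (G)-pair and `W ∼ W'`, `ord_p Δ_min(W') = ord_p Δ_min(W)` or the two add up to `12`** — with gen
  14's dictionary (II ↦ 2, III ↦ 3, IV ↦ 4, I₀* ↦ 6, IV* ↦ 8, III* ↦ 9, II* ↦ 10) the Kodaira type at
  `p` is constant on the class up to II ↔ II*, III ↔ III*, IV ↔ IV*: EXACTLY the 634 mixed classes of
  gen 14's census (Cremona `N < 120 000`), and Edixhoven's exception bit `ord_p Δ_min ≤ 4` (gen 14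
  `kodairaSymbolAt_placeOf_II_or_III_or_IV_iff_of_addv`) is the one datum of the cell that must be read
  on the strong curve itself (`kodaira_le_four_iff_of_isIsogenous_of_typeG`: on the class it is
  determined up to the swap `v ↦ 12 − v`). IN PRINT (not typed here, no named fact introduced):
  T. Dokchitser–V. Dokchitser, *Local invariants of isogenous elliptic curves*, Trans. AMS 367 (2015)
  §3 Cor. 8 / §5 Thm. 22 (arXiv:1208.5519 numbering): for an isogeny of PRIME degree `ℓ` the Kodaira
  type at a potentially good prime is unchanged if `ℓ ≠ p` or the reduction is potentially ORDINARY,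
  and swapped (II ↔ II*, III ↔ III*, IV ↔ IV*) if `ℓ = p` and the reduction is tame potentially
  supersingular — so on the (G-ord) locus the swap never occurs; census gen 15
  (HOME/b2b-bsdres-additive-p2/census/gen15/ISOGENY-CLASS-CENSUS.md, Cremona `N < 5·10⁵`): `v`
  constant on all 90 533 multi-member (G) cells, swapped on exactly the 1 893 non-(G) cells whose
  class has a `p`-isogeny. The kernel statement of this file is the weaker unconditional one.

EFFECT (bookkeeping, no label moves): the class hypotheses `ClassX4Gord W₀ p` / `ClassX4 W₀ p ∧
¬TypeGOrd W₀ p` of gen 14's strong-curve theorems (`GordManinConstant.lean`) may be verified on ANY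
member of the isogeny class; the cell's census (X3♯(G-ord) 334 ‖ 191, X4♯(G-ord) 946 ‖ 240 pairs at
`N < 2·10⁴ ‖ 10⁴`, one optimal curve per class) counts CLASSES in the kernel's sense. Located gap /
labels UNCHANGED (HOME/b2b-bsdres-additive-p2/AUDIT-X34-GORD.md §4 R11).

References: J. H. Silverman, *AEC* III.§4, Cor. VII.7.2; *ATAEC* IV Table 4.1; D. Delbourgo,
Compositio Math. 113 (1998) §1.5; J. E. Cremona, *Algorithms for Modular Elliptic Curves* §3.9;
B. Edixhoven, Progr. Math. 89 (1991) Thm. 3; T. Dokchitser, V. Dokchitser, Trans. AMS 367 (2015)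
4339–4358, Table 1, Cor. 8, Thm. 22 [DokchitserDokchitser2015LocalInvariants].
-/

noncomputable section

open scoped Classical NumberField

open WeierstrassCurve IsDedekindDomain IsDedekindDomain.HeightOneSpectrum NumberField
  Rat.HeightOneSpectrum Literature.NumberTheory.EllipticCurves
  Literature.NumberTheory.EllipticCurves.Rank1Residual
  Literature.NumberTheory.DiophantineGeometry

namespace Summit.BirchSwinnertonDyer.Rank1Residual.Additive

/-! ### The census cell and the sub-classes are isogeny-class properties (every odd `p`) -/

section Classes

variable {W W' : WeierstrassCurve ℚ} [W.IsElliptic] [W.IsGloballyMinimal] [W'.IsElliptic]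
  [W'.IsGloballyMinimal] {p : ℕ} [hp : Fact p.Prime]

/-- **The census cell (G-ord) = `SubGord` is a `ℚ`-isogeny-class property** (odd `p`, `E` additive
at `p`): `SubGord W p ↔ SubGord W' p` — by gen 9's uniform dictionary `subGord_iff_typeG_of_addv`
on both sides and `typeG_iff_of_isIsogenous`. -/
theorem subGord_iff_of_isIsogenous (hp2 : p ≠ 2) (hadd : Addv W p) (h : IsIsogenous W W') :
    SubGord W p ↔ SubGord W' p := by
  constructor
  · intro hS
    have hG : TypeG W p := (subGord_iff_typeG_of_addv W p hp2 hadd).mp hS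
    have hadd' : Addv W' p := Addv.of_isIsogenous_of_typeG hadd hG h
    exact (subGord_iff_typeG_of_addv W' p hp2 hadd').mpr (hG.of_isIsogenous h)
  · intro hS'
    -- `W'` is additive: bad at `p` (isogeny invariance over `ℚ`) and not multiplicative (¬(M))
    have hbad' : ¬ W'.HasGoodReductionAtPrime p := fun hgood ↦
      hadd.1 ((hasGoodReductionAtPrime_iff_of_isIsogenous h p).mpr hgood)
    have hmult' : ¬ W'.HasMultiplicativeReductionAtPrime p := fun hmult ↦
      hS'.1 (EisensteinPrimes.padicValRat_j_neg_of_mult W' p hmult)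
    have hadd' : Addv W' p := ⟨hbad', hmult'⟩
    have hG' : TypeG W' p := (subGord_iff_typeG_of_addv W' p hp2 hadd').mp hS'
    exact (subGord_iff_typeG_of_addv W p hp2 hadd).mpr (hG'.of_isIsogenous h.symm_of_charZero)

/-- **X4♯(G-ord) is a `ℚ`-isogeny-class property** (globally minimal models; `p` odd is part of
`ClassX4`): `ClassX4Gord W p` and `W ∼ W'` ⟹ `ClassX4Gord W' p`. Additivity by
`Addv.of_isIsogenous_of_typeG`, irreducibility of `E'[p]` by the tree's
`not_hasIrreducibleModPGaloisRep_of_isIsogenous` (a class property), (G)-ordinarity by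
`TypeGOrd.of_isIsogenous`. -/
theorem ClassX4Gord.of_isIsogenous (hX : ClassX4Gord W p) (h : IsIsogenous W W') :
    ClassX4Gord W' p := by
  obtain ⟨⟨hp2, hadd, hirr⟩, hG⟩ := hX
  refine ⟨⟨hp2, Addv.of_isIsogenous_of_typeG hadd hG.typeG h, ?_⟩, hG.of_isIsogenous hp2 hadd h⟩
  by_contra hred'
  exact not_hasIrreducibleModPGaloisRep_of_isIsogenous h.symm_of_charZero hred' hirr

/-- **X4♯(G-ord) membership is constant on `ℚ`-isogeny classes**: `ClassX4Gord W p ↔ ClassX4Gord W' p`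
for `W ∼ W'`. -/
theorem classX4Gord_iff_of_isIsogenous (h : IsIsogenous W W') :
    ClassX4Gord W p ↔ ClassX4Gord W' p :=
  ⟨fun hX ↦ hX.of_isIsogenous h, fun hX ↦ hX.of_isIsogenous h.symm_of_charZero⟩

/-- **X3♯(G-ord) is a `ℚ`-isogeny-class property** (odd `p`, globally minimal models):
`ClassX3Gord W p` and `W ∼ W'` ⟹ `ClassX3Gord W' p` (reducibility of `E'[p]` by
`not_hasIrreducibleModPGaloisRep_of_isIsogenous`). -/
theorem ClassX3Gord.of_isIsogenous (hp2 : p ≠ 2) (hX : ClassX3Gord W p) (h : IsIsogenous W W') :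
    ClassX3Gord W' p := by
  obtain ⟨⟨hred, hadd⟩, hG⟩ := hX
  exact ⟨⟨not_hasIrreducibleModPGaloisRep_of_isIsogenous h hred,
    Addv.of_isIsogenous_of_typeG hadd hG.typeG h⟩, hG.of_isIsogenous hp2 hadd h⟩

/-- **X3♯(G-ord) membership is constant on `ℚ`-isogeny classes** (odd `p`):
`ClassX3Gord W p ↔ ClassX3Gord W' p` for `W ∼ W'`. -/
theorem classX3Gord_iff_of_isIsogenous (hp2 : p ≠ 2) (h : IsIsogenous W W') :
    ClassX3Gord W p ↔ ClassX3Gord W' p :=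
  ⟨fun hX ↦ hX.of_isIsogenous hp2 h, fun hX ↦ hX.of_isIsogenous hp2 h.symm_of_charZero⟩

end Classes

/-! ### The Kodaira type on the class of a (G)-pair: `ord_p Δ_min` up to `v ↦ 12 − v` (`p ≥ 5`) -/

section KodairaPair

variable (W : WeierstrassCurve ℚ) [W.IsElliptic] [W.IsGloballyMinimal] (p : ℕ) [hp : Fact p.Prime]

omit [W.IsElliptic] [W.IsGloballyMinimal] in
/-- The residue ring `ℤ ⧸ (p)` at the place `placeOf p` of `ℤ` has characteristic `p`. -/
theorem ringChar_int_quot_placeOf : ringChar (ℤ ⧸ (placeOf p).asIdeal) = p := by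
  have hgen : natGenerator (placeOf p) = p :=
    congrArg Subtype.val ((primesEquiv (R := ℤ)).apply_symm_apply ⟨p, hp.out⟩)
  have hmem : (p : ℤ) ∈ (placeOf p).asIdeal := by
    rw [asIdeal_eq_span_natGenerator_int, hgen]
    exact Ideal.mem_span_singleton_self _
  haveI : Nontrivial (ℤ ⧸ (placeOf p).asIdeal) :=
    Ideal.Quotient.nontrivial_iff.mpr (placeOf p).isPrime.ne_top
  apply CharP.ringChar_of_prime_eq_zero hp.out
  rw [← map_natCast (Ideal.Quotient.mk (placeOf p).asIdeal) p, Ideal.Quotient.eq_zero_iff_mem]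
  exact_mod_cast hmem

/-- **At a POTENTIALLY GOOD additive `p ≥ 5`, `ord_p Δ_min ∈ {2, 3, 4, 6, 8, 9, 10}`** (types II,
III, IV, I₀*, IV*, III*, II*): gen 14's seven additive types `kodairaSymbolAt_placeOf_cases_of_addv`
with `Iₙ*`, `n ≥ 1`, excluded — those have `ord_p j = −n < 0` (Silverman *ATAEC* IV Table 4.1; the
tree's `one_lt_valuation_j_of_kodairaSymbolAt_eq_Istar_succ`, read at the place `placeOf p` of `ℤ`
through `Rat.HeightOneSpectrum.valuation_eq_exp_neg_padicValRat`).
[cite: SilvermanATAEC1994, IV Table 4.1 (PDF p. 365)] -/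
theorem padicValInt_minimalDiscriminantInt_mem_of_addv_of_padicValRat_j_nonneg (hp5 : 5 ≤ p)
    (hadd : Addv W p) (hj : 0 ≤ padicValRat p W.j) :
    padicValInt p W.minimalDiscriminantInt = 2 ∨ padicValInt p W.minimalDiscriminantInt = 3 ∨
      padicValInt p W.minimalDiscriminantInt = 4 ∨ padicValInt p W.minimalDiscriminantInt = 6 ∨
      padicValInt p W.minimalDiscriminantInt = 8 ∨ padicValInt p W.minimalDiscriminantInt = 9 ∨
      padicValInt p W.minimalDiscriminantInt = 10 := by
  rcases kodairaSymbolAt_placeOf_cases_of_addv W p hp5 hadd with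
    ⟨-, hv⟩ | ⟨-, hv⟩ | ⟨-, hv⟩ | ⟨n, hk, hv⟩ | ⟨-, hv⟩ | ⟨-, hv⟩ | ⟨-, hv⟩
  · omega
  · omega
  · omega
  · cases n with
    | zero => omega
    | succ k =>
      exfalso
      have hchar : ringChar (ℤ ⧸ (placeOf p).asIdeal) ≠ 2 := by
        rw [ringChar_int_quot_placeOf p]; omega
      have h1 := one_lt_valuation_j_of_kodairaSymbolAt_eq_Istar_succ (placeOf p) W hchar hk
      have hgen : natGenerator (placeOf p) = p :=
        congrArg Subtype.val ((primesEquiv (R := ℤ)).apply_symm_apply ⟨p, hp.out⟩)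
      have hj0 : W.j ≠ 0 := by
        intro h0
        rw [h0, map_zero] at h1
        exact not_lt.mpr zero_le_one h1
      rw [Rat.HeightOneSpectrum.valuation_eq_exp_neg_padicValRat (placeOf p) hj0, hgen,
        ← WithZero.exp_zero, WithZero.exp_lt_exp] at h1
      linarith
  · omega
  · omega
  · omega

variable {W p} {W' : WeierstrassCurve ℚ} [W'.IsElliptic] [W'.IsGloballyMinimal]

/-- **On the `ℚ`-isogeny class of a (G)-pair the Kodaira type at `p` moves at most `v ↦ 12 − v`**
(`p ≥ 5`, `E` additive at `p` of type (G), globally minimal models, `E ∼ E'`): `ord_p Δ_min(E') =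
ord_p Δ_min(E)` or `ord_p Δ_min(E') + ord_p Δ_min(E) = 12` — both values lie in
`{2, 3, 4, 6, 8, 9, 10}` (`padicValInt_minimalDiscriminantInt_mem_of_addv_of_padicValRat_j_nonneg`, `E'`
additive potentially good by `Addv.of_isIsogenous_of_typeG` / `padicValRat_j_nonneg_of_isIsogenous_of_typeG`)
and have the same `gcd` with `12` (`gcd_padicValInt_minimalDiscriminantInt_eq_of_isIsogenous_of_typeG`).
With gen 14's dictionary: II ↔ II*, III ↔ III*, IV ↔ IV* are the only possible changes of type inside
a class, and I₀* is rigid — the theorem behind gen 14's census of 634 mixed classes.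
[cite: SilvermanATAEC1994, IV Table 4.1 (PDF p. 365)] -/
theorem padicValInt_minimalDiscriminantInt_eq_or_add_eq_twelve_of_isIsogenous_of_typeG (hp5 : 5 ≤ p)
    (hadd : Addv W p) (hG : TypeG W p) (h : IsIsogenous W W') :
    padicValInt p W'.minimalDiscriminantInt = padicValInt p W.minimalDiscriminantInt ∨
      padicValInt p W'.minimalDiscriminantInt + padicValInt p W.minimalDiscriminantInt = 12 := by
  have hv := padicValInt_minimalDiscriminantInt_mem_of_addv_of_padicValRat_j_nonneg W p hp5 hadd
    (padicValRat_j_nonneg_of_typeG W p hG)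
  have hv' := padicValInt_minimalDiscriminantInt_mem_of_addv_of_padicValRat_j_nonneg W' p hp5
    (Addv.of_isIsogenous_of_typeG hadd hG h) (padicValRat_j_nonneg_of_isIsogenous_of_typeG hG h)
  have hg := gcd_padicValInt_minimalDiscriminantInt_eq_of_isIsogenous_of_typeG hp5 hG h
  rcases hv with h1 | h1 | h1 | h1 | h1 | h1 | h1 <;>
    rcases hv' with h2 | h2 | h2 | h2 | h2 | h2 | h2 <;>
    first | omega | (rw [h1, h2] at hg; norm_num at hg)

/-- **Edixhoven's exception bit on the class**: for a (G)-pair (`p ≥ 5`) and `W ∼ W'`, `W'` is of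
type II/III/IV at `p` (`ord_p Δ_min(W') ≤ 4`, gen 14 `kodairaSymbolAt_placeOf_II_or_III_or_IV_iff_of_addv`)
iff `W` is, UNLESS the two minimal discriminant exponents are swapped (`v' + v = 12`); the defect
(hence (G), (G-ord), the class predicates) never changes (`GordIsogenyInvariance.lean`).
[cite: SilvermanATAEC1994, IV Table 4.1 (PDF p. 365)] -/
theorem kodaira_le_four_iff_of_isIsogenous_of_typeG (hp5 : 5 ≤ p) (hadd : Addv W p)
    (hG : TypeG W p) (h : IsIsogenous W W')
    (hne : padicValInt p W'.minimalDiscriminantInt + padicValInt p W.minimalDiscriminantInt ≠ 12) :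
    padicValInt p W'.minimalDiscriminantInt ≤ 4 ↔ padicValInt p W.minimalDiscriminantInt ≤ 4 := by
  rcases padicValInt_minimalDiscriminantInt_eq_or_add_eq_twelve_of_isIsogenous_of_typeG hp5 hadd hG h
    with heq | h12
  · rw [heq]
  · exact absurd h12 hne

end KodairaPair

end Summit.BirchSwinnertonDyer.Rank1Residual.Additive

end
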